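import Literature.Geometry.Riemannian.WeightedGreenComplete
import Literature.Geometry.Riemannian.MarkovOperatorBounds
import Literature.Geometry.Riemannian.GradientEstimateIntegration
import Literature.Geometry.Lorentzian.HessianLinear
import Mathlib.MeasureTheory.Integral.DominatedConvergence
import HarnessLib

/-!
# The weighted heat flow on a complete manifold: decay of the Fisher information and convergence
# to equilibrium from the strong gradient bound

Second layer (after `WeightedGreenComplete.lean`, `MarkovOperatorBounds.lean`) of the proof of the
named fact `bakryEmery_logSobolev_complete` (`BakryEmeryLogSobolev.lean`) from the heat-semigroup fact
`weightedHeatSemigroup_strongGradientBound_complete` (`WeightedHeatSemigroupComplete.lean`): the two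
consequences of the Bakry–Émery–Ledoux strong gradient bound `√Γ(P_t f) ≤ e^{-Kt} P_t √Γ(f)`
(D. Bakry, I. Gentil, M. Ledoux, *Analysis and Geometry of Markov Diffusion Operators* (2014),
Thm. 3.2.4) that the Bakry–Émery argument consumes on a complete non-compact manifold, for a Markov
operator `T` (hypotheses `hlin`, `hpos`, `hone` as in `MarkovOperatorBounds.lean`) and `u = T f`:

* `dalembertian_const_eq_zero`, `weightedLaplacian_eq_zero_of_eventuallyConst` — `Lf = 0` outside a
  compact set off which `f` is constant (so `Lf` is bounded);
* `gradSq_div_le_of_strongGradientBound` — **the Fisher commutation** `|∇u|²/u ≤ c² T(|∇f|²/f)` from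
  `√|∇u|² ≤ c T√|∇f|²` by the Cauchy–Schwarz inequality for `T` (BGL Thm. 5.5.2, (ii) ⇒ (v));
* `integral_gradSq_div_le` — **`I(u) ≤ c² I(f)`** by invariance of the measure (BGL, proof of
  Prop. 5.7.1);
* `abs_sub_le_mul_toReal_edist` — a gradient bound is a Lipschitz bound for the Riemannian distance;
* `tendsto_entropy_complete` — **convergence to equilibrium**: `C¹` functions `u(t)` with values in
  `[a, b]`, `a > 0`, unit weighted mass and `|∇u(t)|² ≤ e^{-2Kt}C` satisfy `u(t, x) → 1` and
  `∫ u(t) log u(t) e^{-V} dV_g → 0` (dominated convergence; the distance is finite on a connected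
  manifold) — the non-compact replacement of `heatFlow_tendstoUniformly`.

Theorems only; no definitions, no named facts.

## References

* [BakryGentilLedoux2014] D. Bakry, I. Gentil, M. Ledoux, *Analysis and Geometry of Markov Diffusion
  Operators*, Springer 2014, Thm. 3.2.4 (p. 144), Thm. 3.2.7 (p. 148), Thm. 5.5.2 (p. 259),
  Prop. 5.7.1 (p. 268). READ (held text).
* [CarrilloNi2009] J. A. Carrillo, L. Ni, Comm. Anal. Geom. 17 (2009), §3 (pp. 7–8).
-/

noncomputable section

open Bundle Set Function Filter Manifold MeasureTheory
open scoped Manifold ContDiff Topology ENNReal NNReal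

namespace Literature.Geometry.Riemannian

open Lorentzian Lorentzian.PseudoRiemannianMetric

universe uM

/-! ### Functions constant outside a compact set: the weighted Laplacian vanishes outside it -/

section EventuallyConst

variable {n : ℕ} {M : Type uM} [TopologicalSpace M] [ChartedSpace (EuclideanSpace ℝ (Fin n)) M]
  [IsManifold (𝓡 n) ∞ M]
  {g : PseudoRiemannianMetric (𝓡 n) ∞ (EuclideanSpace ℝ (Fin n)) (TangentSpace (𝓡 n) : M → Type _)}
  [g.HasLeviCivita]

/-- `Δ_g c = 0` for a constant (chain rule with a constant outer function). [folklore] -/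
theorem dalembertian_const_eq_zero (c : ℝ) (x : M) : g.dalembertian (fun _ : M ↦ c) x = 0 := by
  have h := g.dalembertian_real_comp (u := fun _ : M ↦ (0 : ℝ)) (ζ := fun _ : ℝ ↦ c) (x := x)
    contMDiffAt_const contDiffAt_const
  have hc : ((fun _ : ℝ ↦ c) ∘ fun _ : M ↦ (0 : ℝ)) = fun _ : M ↦ c := rfl
  rw [hc] at h
  simpa using h

/-- **The weighted Laplacian of a function constant outside a compact set vanishes outside that
set**: `Δ_g f − g⁻¹(dV, df) = 0` at `x ∉ K₀` if `f = c` off the compact `K₀` (locality of `Δ_g` and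
of `d`). [folklore] -/
theorem weightedLaplacian_eq_zero_of_eventuallyConst [T2Space M] {f V : M → ℝ} (hf : ContMDiff (𝓡 n) 𝓘(ℝ, ℝ) ∞ f)
    {K₀ : Set M} (hK₀ : IsCompact K₀) {c : ℝ} (hc : ∀ x, x ∉ K₀ → f x = c) {x : M} (hx : x ∉ K₀) :
    g.dalembertian f x - g.innerDual x (mvfderiv (𝓡 n) V x : TangentSpace (𝓡 n) x →ₗ[ℝ] ℝ)
      (mvfderiv (𝓡 n) f x : TangentSpace (𝓡 n) x →ₗ[ℝ] ℝ) = 0 := by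
  have hd : mvfderiv (𝓡 n) f x = 0 := mvfderiv_eq_zero_of_eventuallyConst hK₀ hc hx
  have hΔ : g.dalembertian f x = 0 := by
    have h1 : f = (fun y ↦ f y - c) + fun _ ↦ c := by funext y; simp
    have hu : ContMDiffAt (𝓡 n) 𝓘(ℝ, ℝ) 2 (fun y ↦ f y - c) x :=
      ((hf.sub contMDiff_const).of_le (WithTop.coe_le_coe.mpr le_top)).contMDiffAt
    have hv : ContMDiffAt (𝓡 n) 𝓘(ℝ, ℝ) 2 (fun _ : M ↦ c) x := contMDiffAt_const
    have hz : g.dalembertian (fun y ↦ f y - c) x = 0 := by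
      refine g.dalembertian_eq_zero_of_eventuallyEq_zero ?_
      filter_upwards [hK₀.isClosed.isOpen_compl.mem_nhds hx] with y hy
      simp [hc y hy]
    rw [h1, g.dalembertian_add_of_contMDiffAt hu hv, hz, dalembertian_const_eq_zero, add_zero]
  rw [hΔ, hd]
  simp [PseudoRiemannianMetric.innerDual]

end EventuallyConst

/-! ### The Fisher information and the entropy along `u = T f` -/

section Flow

variable {n : ℕ} {M : Type uM} [TopologicalSpace M] [T2Space M] [SecondCountableTopology M]
  [ChartedSpace (EuclideanSpace ℝ (Fin n)) M] [IsManifold (𝓡 n) ∞ M] [ConnectedSpace M]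
  [T3Space M] [MeasurableSpace M] [BorelSpace M]
  {g : PseudoRiemannianMetric (𝓡 n) ∞ (EuclideanSpace ℝ (Fin n)) (TangentSpace (𝓡 n) : M → Type _)}
  [g.HasLeviCivita]

omit [T2Space M] [SecondCountableTopology M] [ConnectedSpace M] [T3Space M] [MeasurableSpace M]
  [BorelSpace M] [g.HasLeviCivita] in
/-- **The pointwise Fisher commutation from the strong gradient bound** (Bakry–Gentil–Ledoux 2014,
(5.5.5)–(5.5.6)): if `T` is a Markov operator, `u = T f` with `f ≥ a > 0` bounded continuous of
bounded gradient, and `√|∇u|² ≤ c · T(√|∇f|²)` pointwise (`c ≥ 0`), then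
`|∇u|²/u ≤ c² T(|∇f|²/f)` pointwise — Cauchy–Schwarz `(T√Γf)² = (T(√(Γf/f)·√f))² ≤ T(Γf/f) T f`.
[cite: BakryGentilLedoux2014, Thm. 5.5.2 (ii) ⇒ (v), p. 259] -/
theorem gradSq_div_le_of_strongGradientBound (hg : g.IsRiemannian) {T : (M → ℝ) → M → ℝ}
    (hlin : ∀ (h₁ h₂ : M → ℝ) (c : ℝ), Continuous h₁ → (∃ C, ∀ x, |h₁ x| ≤ C) →
      Continuous h₂ → (∃ C, ∀ x, |h₂ x| ≤ C) →
      T (fun x ↦ c * h₁ x + h₂ x) = fun x ↦ c * T h₁ x + T h₂ x)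
    (hpos : ∀ h : M → ℝ, Continuous h → (∃ C, ∀ x, |h x| ≤ C) → (∀ x, 0 ≤ h x) → ∀ x, 0 ≤ T h x)
    (hone : T (fun _ ↦ (1 : ℝ)) = fun _ ↦ 1) {f : M → ℝ} (hf : ContMDiff (𝓡 n) 𝓘(ℝ, ℝ) ∞ f) (hfb : ∃ C, ∀ x, |f x| ≤ C)
    (hΓfb : ∃ C, ∀ x, g.gradSq f x ≤ C) {a : ℝ} (ha : 0 < a) (hfa : ∀ x, a ≤ f x)
    {u : M → ℝ} (hu : u = T f) {c : ℝ}
    (hgrad : ∀ x, Real.sqrt (g.gradSq u x) ≤ c * T (fun y ↦ Real.sqrt (g.gradSq f y)) x) (x : M) :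
    g.gradSq u x / u x ≤ c ^ 2 * T (fun y ↦ g.gradSq f y / f y) x := by
  obtain ⟨Cf, hCf⟩ := hfb
  obtain ⟨CΓ, hCΓ⟩ := hΓfb
  have hfpos : ∀ y, 0 < f y := fun y ↦ ha.trans_le (hfa y)
  have hΓ0 : ∀ y, 0 ≤ g.gradSq f y := fun y ↦ g.gradSq_nonneg hg f y
  have hfc : Continuous f := hf.continuous
  have hΓc : Continuous (g.gradSq f) := (contMDiff_gradSq g hf).continuous
  -- the two square roots
  set φ : M → ℝ := fun y ↦ Real.sqrt (g.gradSq f y / f y) with hφdef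
  set ψ : M → ℝ := fun y ↦ Real.sqrt (f y) with hψdef
  have hφc : Continuous φ := (hΓc.div hfc fun y ↦ (hfpos y).ne').sqrt
  have hψc : Continuous ψ := hfc.sqrt
  have hφb : ∃ C, ∀ y, |φ y| ≤ C := ⟨Real.sqrt (CΓ / a), fun y ↦ by
    rw [hφdef, abs_of_nonneg (Real.sqrt_nonneg _)]
    exact Real.sqrt_le_sqrt (div_le_div₀ ((hΓ0 y).trans (hCΓ y)) (hCΓ y) ha (hfa y))⟩
  have hψb : ∃ C, ∀ y, |ψ y| ≤ C := ⟨Real.sqrt Cf, fun y ↦ by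
    rw [hψdef, abs_of_nonneg (Real.sqrt_nonneg _)]
    exact Real.sqrt_le_sqrt ((le_abs_self _).trans (hCf y))⟩
  have hCS := markov_sq_apply_mul_le hlin hpos hφc hφb hψc hψb x
  have hprod : (fun y ↦ φ y * ψ y) = fun y ↦ Real.sqrt (g.gradSq f y) := by
    funext y
    rw [hφdef, hψdef, ← Real.sqrt_mul (div_nonneg (hΓ0 y) (hfpos y).le),
      div_mul_cancel₀ _ (hfpos y).ne']
  have hφ2 : (fun y ↦ φ y ^ 2) = fun y ↦ g.gradSq f y / f y := by
    funext y; rw [hφdef, Real.sq_sqrt (div_nonneg (hΓ0 y) (hfpos y).le)]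
  have hψ2 : (fun y ↦ ψ y ^ 2) = f := by
    funext y; rw [hψdef, Real.sq_sqrt (hfpos y).le]
  rw [hprod, hφ2, hψ2] at hCS
  -- `u ≥ a > 0`, `T√Γf ≥ 0`
  have hux : a ≤ u x := by rw [hu]; exact (markov_apply_mem_Icc hlin hpos hone hfc hfa (fun y ↦ (le_abs_self _).trans (hCf y)) x).1
  have hupos : 0 < u x := ha.trans_le hux
  have hT0 : 0 ≤ T (fun y ↦ Real.sqrt (g.gradSq f y)) x :=
    hpos _ hΓc.sqrt ⟨Real.sqrt CΓ, fun y ↦ by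
      rw [abs_of_nonneg (Real.sqrt_nonneg _)]; exact Real.sqrt_le_sqrt (hCΓ y)⟩
      (fun y ↦ Real.sqrt_nonneg _) x
  -- `Γ(u) ≤ c² (T√Γf)² ≤ c² T(Γf/f) u`
  have h1 : g.gradSq u x ≤ c ^ 2 * (T (fun y ↦ Real.sqrt (g.gradSq f y)) x) ^ 2 := by
    have h0 : 0 ≤ Real.sqrt (g.gradSq u x) := Real.sqrt_nonneg _
    have h2 := pow_le_pow_left₀ h0 (hgrad x) 2
    rw [Real.sq_sqrt (g.gradSq_nonneg hg u x), mul_pow] at h2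
    exact h2
  have h3 : g.gradSq u x ≤ c ^ 2 * (T (fun y ↦ g.gradSq f y / f y) x * u x) := by
    refine h1.trans (mul_le_mul_of_nonneg_left ?_ (sq_nonneg _))
    rw [hu]; exact hCS
  rw [div_le_iff₀ hupos]
  linarith

omit [T2Space M] [SecondCountableTopology M] [ConnectedSpace M] [g.HasLeviCivita] in
/-- **The Fisher information decays along the flow: `I(u) ≤ c² I(f)`** once
`|∇u|²/u ≤ c² T(|∇f|²/f)` pointwise and `T` leaves the measure `w dV_g` invariant on `|∇f|²/f`
(Bakry–Gentil–Ledoux 2014, proof of Prop. 5.7.1: `I_μ(P_t f) ≤ e^{-2ρt} I_μ(f)`).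
[cite: BakryGentilLedoux2014, Prop. 5.7.1 (proof, p. 268)] -/
theorem integral_gradSq_div_le (hg : g.IsRiemannian) {T : (M → ℝ) → M → ℝ}
    (hlin : ∀ (h₁ h₂ : M → ℝ) (c : ℝ), Continuous h₁ → (∃ C, ∀ x, |h₁ x| ≤ C) →
      Continuous h₂ → (∃ C, ∀ x, |h₂ x| ≤ C) →
      T (fun x ↦ c * h₁ x + h₂ x) = fun x ↦ c * T h₁ x + T h₂ x)
    (hpos : ∀ h : M → ℝ, Continuous h → (∃ C, ∀ x, |h x| ≤ C) → (∀ x, 0 ≤ h x) → ∀ x, 0 ≤ T h x)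
    (hone : T (fun _ ↦ (1 : ℝ)) = fun _ ↦ 1)
    {f u w : M → ℝ} (hf : ContMDiff (𝓡 n) 𝓘(ℝ, ℝ) ∞ f)
    (hΓfb : ∃ C, ∀ x, g.gradSq f x ≤ C) {a : ℝ} (ha : 0 < a) (hfa : ∀ x, a ≤ f x)
    (hupos : ∀ x, 0 < u x) (hw0 : ∀ x, 0 ≤ w x) (hw : Integrable w g.riemVolume) {c : ℝ}
    (hpt : ∀ x, g.gradSq u x / u x ≤ c ^ 2 * T (fun y ↦ g.gradSq f y / f y) x)
    (hTc : Continuous (T (fun y ↦ g.gradSq f y / f y)))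
    (hinv : ∫ x, T (fun y ↦ g.gradSq f y / f y) x * w x ∂g.riemVolume =
      ∫ x, g.gradSq f x / f x * w x ∂g.riemVolume) :
    ∫ x, g.gradSq u x / u x * w x ∂g.riemVolume ≤
      c ^ 2 * ∫ x, g.gradSq f x / f x * w x ∂g.riemVolume := by
  obtain ⟨CΓ, hCΓ⟩ := hΓfb
  have hfpos : ∀ y, 0 < f y := fun y ↦ ha.trans_le (hfa y)
  have hΓ0 : ∀ y, 0 ≤ g.gradSq f y := fun y ↦ g.gradSq_nonneg hg f y
  have hQc : Continuous (fun y ↦ g.gradSq f y / f y) :=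
    (contMDiff_gradSq g hf).continuous.div hf.continuous fun y ↦ (hfpos y).ne'
  have hQ0 : ∀ y, 0 ≤ g.gradSq f y / f y := fun y ↦ div_nonneg (hΓ0 y) (hfpos y).le
  have hQb : ∀ y, g.gradSq f y / f y ≤ CΓ / a := fun y ↦
    div_le_div₀ ((hΓ0 y).trans (hCΓ y)) (hCΓ y) ha (hfa y)
  have hTb : ∃ C, ∀ x, |T (fun y ↦ g.gradSq f y / f y) x| ≤ C := ⟨CΓ / a, fun x ↦ by
    have h := markov_apply_mem_Icc hlin hpos hone hQc hQ0 hQb x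
    rw [abs_of_nonneg h.1]; exact h.2⟩
  have hI : Integrable (fun x ↦ c ^ 2 * (T (fun y ↦ g.gradSq f y / f y) x * w x)) g.riemVolume :=
    (integrable_mul_weight hTc hTb hw).const_mul _
  rw [← hinv, ← integral_const_mul]
  refine integral_mono_of_nonneg (Eventually.of_forall fun x ↦ ?_) hI (Eventually.of_forall fun x ↦ ?_)
  · exact mul_nonneg (div_nonneg (g.gradSq_nonneg hg u x) (hupos x).le) (hw0 x)
  · have h := mul_le_mul_of_nonneg_right (hpt x) (hw0 x)
    simpa only [mul_assoc] using h

omit [T2Space M] [SecondCountableTopology M] [T3Space M] [MeasurableSpace M] [BorelSpace M]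
  [g.HasLeviCivita] in
/-- **A gradient bound is a Lipschitz bound on a connected Riemannian manifold**: if `u ∈ C¹` with
`|∇u|²_g ≤ L²` (`L ≥ 0`), then `|u(x) − u(y)| ≤ L d_g(x, y)` (integration along almost minimising
curves, `ofReal_abs_sub_le_mul_riemEDist`; the distance is finite on a connected manifold). [folklore] -/
theorem abs_sub_le_mul_toReal_edist (hg : g.IsRiemannian) {u : M → ℝ}
    (hu : ContMDiff (𝓡 n) 𝓘(ℝ, ℝ) 1 u) {L : ℝ} (hL : 0 ≤ L)
    (hgrad : ∀ x, g.gradSq u x ≤ L ^ 2) (x y : M) :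
    |u x - u y| ≤ L * (g.edist hg x y).toReal := by
  set L' : ℝ≥0 := ⟨L, hL⟩ with hL'
  have hdf : ∀ z ∈ (univ : Set M), ∀ v : TangentSpace (𝓡 n) z,
      |mvfderiv (𝓡 n) u z v| ≤ L' * Real.sqrt (g.val z v v) := by
    intro z _ v
    have h2 : Real.sqrt (g.gradSq u z) ≤ L := by
      rw [← Real.sqrt_sq hL]
      exact Real.sqrt_le_sqrt (hgrad z)
    exact (abs_mvfderiv_le_sqrt_gradSq_mul_sqrt g hg u z v).trans
      (mul_le_mul_of_nonneg_right h2 (Real.sqrt_nonneg _))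
  have hfin : g.riemEDist x y ≠ ⊤ := by
    rw [PseudoRiemannianMetric.riemEDist_eq hg]
    exact PseudoRiemannianMetric.edist_ne_top hg x y
  have hy : y ∈ g.ball x ⊤ := by
    rw [PseudoRiemannianMetric.mem_ball]
    exact lt_top_iff_ne_top.2 hfin
  have key := ofReal_abs_sub_le_mul_riemEDist g hg isOpen_univ hu.contMDiffOn hdf
    (x := x) (ρ := ⊤) (subset_univ _) hy
  rw [ENNReal.ofReal_le_iff_le_toReal (ENNReal.mul_ne_top ENNReal.coe_ne_top hfin),
    ENNReal.toReal_mul, PseudoRiemannianMetric.riemEDist_eq hg] at key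
  have hcoe : ((L' : ℝ≥0∞)).toReal = L := by rw [ENNReal.coe_toReal]; rfl
  rw [hcoe] at key
  exact key

omit [T2Space M] [SecondCountableTopology M] [g.HasLeviCivita] in
/-- **Convergence to equilibrium on a complete manifold of unit weighted volume**: if `u(t, ·)`,
`t ≥ 0`, are `C¹` functions with values in `[a, b]`, `a > 0`, unit weighted mass
`∫ u(t) e^{-V} dV_g = 1 = ∫ e^{-V} dV_g` and `|∇u(t)|² ≤ e^{-2Kt} C` (`K > 0`), then `u(t, x) → 1` for
every `x` and the entropy `∫ u(t) log u(t) e^{-V} dV_g → 0` as `t → ∞`: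
`|u(t,x) − 1| = |∫ (u(t,x) − u(t,y)) e^{-V(y)} dV_g(y)| ≤ ∫ min(b − a, e^{-Kt}√C d(x,y)) e^{-V}`, dominated
convergence twice (the distance is finite on a connected manifold). This replaces the uniform
convergence of the compact case (`heatFlow_tendstoUniformly`).
[cite: BakryGentilLedoux2014, Thm. 3.2.7 (proof, p. 148) and §1.6 (ergodicity)] -/
theorem tendsto_entropy_complete (hg : g.IsRiemannian) {V : M → ℝ} (hV : ContMDiff (𝓡 n) 𝓘(ℝ, ℝ) ∞ V)
    (hw : Integrable (fun x ↦ Real.exp (-V x)) g.riemVolume)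
    (hmass : ∫ x, Real.exp (-V x) ∂g.riemVolume = 1)
    {u : ℝ → M → ℝ} (huc : ∀ t ∈ Ici (0 : ℝ), ContMDiff (𝓡 n) 𝓘(ℝ, ℝ) 1 (u t))
    {a b : ℝ} (ha : 0 < a) (hab : ∀ t ∈ Ici (0 : ℝ), ∀ x, a ≤ u t x ∧ u t x ≤ b)
    {K C : ℝ} (hK : 0 < K) (hC : 0 ≤ C)
    (hgrad : ∀ t ∈ Ici (0 : ℝ), ∀ x, g.gradSq (u t) x ≤ (Real.exp (-K * t)) ^ 2 * C)
    (hmassu : ∀ t ∈ Ici (0 : ℝ), ∫ x, u t x * Real.exp (-V x) ∂g.riemVolume = 1) :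
    Tendsto (fun t ↦ ∫ x, u t x * Real.log (u t x) * Real.exp (-V x) ∂g.riemVolume) atTop (𝓝 0) := by
  set w : M → ℝ := fun x ↦ Real.exp (-V x) with hwdef
  have hwc : Continuous w := Real.continuous_exp.comp hV.continuous.neg
  have hw0 : ∀ x, 0 ≤ w x := fun x ↦ (Real.exp_pos _).le
  have hdecay : Tendsto (fun t : ℝ ↦ Real.exp (-K * t)) atTop (𝓝 0) := by
    have h1 : Tendsto (fun t : ℝ ↦ -K * t) atTop atBot :=
      tendsto_id.const_mul_atTop_of_neg (by linarith)
    exact Real.tendsto_exp_atBot.comp h1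
  /- (1) pointwise convergence `u(t, x₀) → 1` -/
  have hpt : ∀ x₀, Tendsto (fun t ↦ u t x₀) atTop (𝓝 1) := by
    intro x₀
    set D : M → ℝ := fun y ↦ (g.edist hg x₀ y).toReal with hDdef
    -- Lipschitz bound
    have hlip : ∀ t ∈ Ici (0 : ℝ), ∀ y, |u t x₀ - u t y| ≤ Real.exp (-K * t) * Real.sqrt C * D y := by
      intro t ht y
      have hL : 0 ≤ Real.exp (-K * t) * Real.sqrt C := by positivity
      have hg' : ∀ x, g.gradSq (u t) x ≤ (Real.exp (-K * t) * Real.sqrt C) ^ 2 := fun x ↦ by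
        rw [mul_pow, Real.sq_sqrt hC]; exact hgrad t ht x
      exact abs_sub_le_mul_toReal_edist hg (huc t ht) hL hg' x₀ y
    -- `|u(t,x₀) − 1| ≤ ∫ |u(t,x₀) − u(t,y)| w`
    have hdiff : ∀ t ∈ Ici (0 : ℝ), |u t x₀ - 1| ≤ ∫ y, |u t x₀ - u t y| * w y ∂g.riemVolume := by
      intro t ht
      have hub : ∃ C', ∀ y, |u t y| ≤ C' := ⟨max |a| |b|, fun y ↦
        abs_le_max_abs_abs (hab t ht y).1 (hab t ht y).2⟩
      have i1 : Integrable (fun y ↦ u t x₀ * w y) g.riemVolume := hw.const_mul _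
      have i2 : Integrable (fun y ↦ u t y * w y) g.riemVolume :=
        integrable_mul_weight (huc t ht).continuous hub hw
      have h1 : u t x₀ - 1 = ∫ y, (u t x₀ - u t y) * w y ∂g.riemVolume := by
        have h2 : ∫ y, (u t x₀ - u t y) * w y ∂g.riemVolume =
            ∫ y, (u t x₀ * w y - u t y * w y) ∂g.riemVolume :=
          integral_congr_ae (Eventually.of_forall fun y ↦ by ring)
        rw [h2, integral_sub i1 i2, integral_const_mul, hmassu t ht]
        simp only [hwdef]
        rw [hmass, mul_one]
      rw [h1, ← Real.norm_eq_abs]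
      refine (norm_integral_le_integral_norm _).trans (le_of_eq ?_)
      refine integral_congr_ae (Eventually.of_forall fun y ↦ ?_)
      simp only [Real.norm_eq_abs, abs_mul, abs_of_nonneg (hw0 y)]
    -- the right-hand sides tend to `0`
    have hF : Tendsto (fun t ↦ ∫ y, |u t x₀ - u t y| * w y ∂g.riemVolume) atTop (𝓝 0) := by
      have h0 : (∫ y, (fun _ : M ↦ (0 : ℝ)) y ∂g.riemVolume) = 0 := by simp
      rw [← h0]
      refine tendsto_integral_filter_of_dominated_convergence (fun y ↦ (b - a) * w y) ?_ ?_
        (hw.const_mul _) (Eventually.of_forall fun y ↦ ?_)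
      · filter_upwards [eventually_ge_atTop (0 : ℝ)] with t ht
        exact ((continuous_const.sub (huc t ht).continuous).abs.mul hwc).aestronglyMeasurable
      · filter_upwards [eventually_ge_atTop (0 : ℝ)] with t ht
        refine Eventually.of_forall fun y ↦ ?_
        rw [Real.norm_eq_abs, abs_mul, abs_abs, abs_of_nonneg (hw0 y)]
        refine mul_le_mul_of_nonneg_right ?_ (hw0 y)
        have h1 := hab t ht x₀; have h2 := hab t ht y
        rw [abs_sub_le_iff]; constructor <;> linarith
      · -- `0 ≤ |u(t,x₀) − u(t,y)| w ≤ e^{-Kt} √C D(y) w(y) → 0`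
        have hup : Tendsto (fun t ↦ Real.exp (-K * t) * Real.sqrt C * D y * w y) atTop (𝓝 0) := by
          simpa using ((hdecay.mul_const (Real.sqrt C)).mul_const (D y)).mul_const (w y)
        refine squeeze_zero' (Eventually.of_forall fun t ↦ mul_nonneg (abs_nonneg _) (hw0 y)) ?_ hup
        filter_upwards [eventually_ge_atTop (0 : ℝ)] with t ht
        exact mul_le_mul_of_nonneg_right (hlip t ht y) (hw0 y)
    -- conclusion
    rw [tendsto_iff_norm_sub_tendsto_zero]
    refine squeeze_zero' (Eventually.of_forall fun t ↦ norm_nonneg _) ?_ hF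
    filter_upwards [eventually_ge_atTop (0 : ℝ)] with t ht
    rw [Real.norm_eq_abs]
    exact hdiff t ht
  /- (2) dominated convergence for the entropy -/
  set Clog : ℝ := max |Real.log a| |Real.log b| with hClog
  have h0 : (∫ y, (fun y : M ↦ (1 : ℝ) * Real.log 1 * w y) y ∂g.riemVolume) = 0 := by simp
  rw [← h0]
  refine tendsto_integral_filter_of_dominated_convergence (fun y ↦ max |a| |b| * Clog * w y) ?_ ?_
    (hw.const_mul _) (Eventually.of_forall fun y ↦ ?_)
  · filter_upwards [eventually_ge_atTop (0 : ℝ)] with t ht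
    have hpos : ∀ y, u t y ≠ 0 := fun y ↦ (ha.trans_le (hab t ht y).1).ne'
    exact (((huc t ht).continuous.mul ((huc t ht).continuous.log hpos)).mul hwc).aestronglyMeasurable
  · filter_upwards [eventually_ge_atTop (0 : ℝ)] with t ht
    refine Eventually.of_forall fun y ↦ ?_
    rw [Real.norm_eq_abs, abs_mul, abs_mul, abs_of_nonneg (hw0 y)]
    refine mul_le_mul_of_nonneg_right (mul_le_mul (abs_le_max_abs_abs (hab t ht y).1 (hab t ht y).2)
      (abs_le_max_abs_abs (Real.log_le_log ha (hab t ht y).1)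
      (Real.log_le_log (ha.trans_le (hab t ht y).1) (hab t ht y).2)) (abs_nonneg _)
      (le_trans (abs_nonneg _) (le_max_left _ _))) (hw0 y)
  · exact (((hpt y).mul ((hpt y).log one_ne_zero)).mul_const (w y))

end Flow

end Literature.Geometry.Riemannian

end
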